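import Summits.NavierStokesRegularity.FluidComputer.DssGermBackwardExtension
import Literature.Analysis.FluidPDE.ClassicalSolutionRescale
import HarnessLib

/-!
# A classical DSS germ near the blow-up time is the terminal piece of an ANCIENT classical DSS
# solution (time-locality of classical solutions + scaling covariance)

Summit `NavierStokesRegularity`, cell topic directory `FluidComputer`, namespace
`…FluidComputer.SelfSimilarCensus`; zone Z7 of the D-0081 profile search. Companion of
`DssGermBackwardExtension.lean` (pure scaling: a DSS germ `nsRescale c⁻¹ u = u` on a terminal
interval `(T₁, 0)` extends uniquely to a globally `c`-DSS field `ũ`, which on every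
`((cᵏ)² T₁, 0)` is the rescaled copy `nsRescale (c⁻¹)ᵏ u`). Here the SOLUTION property is
transported: classical Navier–Stokes solutions (`IsClassicalNSSolutionOn`, Fefferman's class, any
viscosity `ν`, any finite-dimensional `E`) are scaling covariant
(`IsClassicalNSSolutionOn.nsRescale_holds`, Leray 1934 §20 — DISCHARGED in the tree) and local in
time (`isClassicalNSSolutionOn_of_locally`, proved here), so the extension of a classical DSS germ is
a classical solution on the whole past `(−∞, 0)`. PROVED theorems only; no definitions, no named facts.

## Content

* §1 `isClassicalNSSolutionOn_of_locally` — TIME-LOCALITY OF CLASSICAL SOLUTIONS: on an OPEN time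
  set `S`, a pair `(u, p)` that near every `t ∈ S` agrees (on an open time-neighbourhood `V ⊆ S`,
  all of space) with some classical solution on `V` is a classical solution on `S` (joint
  smoothness is local, `contDiffOn_of_locally_contDiffOn`; the one-sided time derivative within an
  open set is the two-sided one, which is local; the other terms are slice-wise).
* §2 **`exists_ancient_classical_dss_extension`** — `c > 1`, `T₁ < 0`; `(u, p)` a classical
  solution of the unforced system on `(T₁, 0)` with the germ relations `nsRescale c⁻¹ u t = u t`,
  `nsRescalePressure c⁻¹ p t = p t` there. Then there are `(ũ, p̃)` with `IsDiscretelySelfSimilar c ũ`,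
  `nsRescalePressure c p̃ = p̃`, `ũ = u` and `p̃ = p` on `(T₁, 0)`, and
  `IsClassicalNSSolutionOn (Iio 0) ν 0 ũ p̃` — an ANCIENT classical `c`-DSS solution; by
  `dss_extension_unique` it is the only `c`-DSS field through the germ.
* §2 `hasTypeIDecay_of_germ` — the scale-invariant Type-I bound `‖u(t, x)‖ ≤ C₀/(‖x‖ + √(−t))`
  passes from the germ to the whole extension (`HasTypeIDecay C₀ ũ`), with the same constant.

READING for the Z7 row (lead's pen): for CLASSICAL objects «exact DSS blow-up germ on a terminal
slab» = «ancient classical DSS solution» (same viscosity, same factor, same Type-I constant); the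
(K-a) kernel floors are stated for the ancient MILD class (`rdssClass_*`: `IsAncientMildSolution`),
and the classical-to-mild step is the remaining formulation gap, not addressed here.

WHAT THIS IS NOT: not an existence claim, not a statement that a given blow-up object IS classical
up to the blow-up time on whole slices (that is the hypothesis), not Navier–Stokes evidence;
«violates: none — no object». Tree search: `lean search 'IsClassicalNSSolutionOn.*(glue|mono|nsRescale)'`
— `IsClassicalNSSolutionOn.mono` (restriction), `.glue` / `glue_of_jetsMatch` (gluing ACROSS a time
interface with matching jets), `nsRescale_holds`; no open-cover locality lemma, no backward extension.

References: J. Leray, Acta Math. 63 (1934), §20 [Leray1934]; C. Fefferman, Clay problem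
description (2000), (1)–(6) [Fefferman2006]; Z. Bradshaw, T.-P. Tsai, Analysis & PDE 12 (2019),
§4.2 [BradshawTsai2019].
-/

noncomputable section

open Set Filter Topology Function
open scoped ContDiff

namespace Summit.NavierStokesRegularity.FluidComputer.SelfSimilarCensus

open Literature.Analysis.FluidPDE

/-! ### §1 Time-locality of classical solutions on an open time set -/

section Locality

variable {E : Type*} [NormedAddCommGroup E] [InnerProductSpace ℝ E] [FiniteDimensional ℝ E]
variable {S : Set ℝ} {ν : ℝ} {f u : ℝ → E → E} {p : ℝ → E → ℝ}

/-- **Time-locality of classical solutions.** Let `S` be an OPEN time set and suppose that for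
every `t ∈ S` there are an open `V` with `t ∈ V ⊆ S` and a classical solution `(u', p')` (viscosity
`ν`, force `f`) on `V` with `u = u'` and `p = p'` at every time of `V` (as functions on `E`). Then
`(u, p)` is a classical solution on `S`. (Joint `C^∞` smoothness on `S × E` is local; on open time
sets `timeDerivWithin` is the two-sided derivative, which only sees a neighbourhood; convection,
Laplacian, pressure gradient and divergence are computed slice by slice.) [folklore] -/
theorem isClassicalNSSolutionOn_of_locally (hS : IsOpen S)
    (hloc : ∀ t ∈ S, ∃ V : Set ℝ, IsOpen V ∧ t ∈ V ∧ V ⊆ S ∧ ∃ (u' : ℝ → E → E) (p' : ℝ → E → ℝ),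
      IsClassicalNSSolutionOn V ν f u' p' ∧ (∀ s ∈ V, u s = u' s) ∧ ∀ s ∈ V, p s = p' s) :
    IsClassicalNSSolutionOn S ν f u p where
  smooth_velocity := by
    refine contDiffOn_of_locally_contDiffOn fun z hz => ?_
    obtain ⟨V, hV, htV, hVS, u', p', h', hu, -⟩ := hloc z.1 hz.1
    refine ⟨V ×ˢ univ, hV.prod isOpen_univ, ⟨htV, mem_univ _⟩, ?_⟩
    have hsub : S ×ˢ (univ : Set E) ∩ V ×ˢ univ ⊆ V ×ˢ univ := inter_subset_right
    refine (h'.smooth_velocity.congr ?_).mono hsub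
    rintro ⟨s, x⟩ ⟨hs, -⟩
    simp only [uncurry_apply_pair, hu s hs]
  smooth_pressure := by
    refine contDiffOn_of_locally_contDiffOn fun z hz => ?_
    obtain ⟨V, hV, htV, hVS, u', p', h', -, hp⟩ := hloc z.1 hz.1
    refine ⟨V ×ˢ univ, hV.prod isOpen_univ, ⟨htV, mem_univ _⟩, ?_⟩
    have hsub : S ×ˢ (univ : Set E) ∩ V ×ˢ univ ⊆ V ×ˢ univ := inter_subset_right
    refine (h'.smooth_pressure.congr ?_).mono hsub
    rintro ⟨s, x⟩ ⟨hs, -⟩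
    simp only [uncurry_apply_pair, hp s hs]
  momentum t ht x := by
    obtain ⟨V, hV, htV, hVS, u', p', h', hu, hp⟩ := hloc t ht
    have e1 : timeDerivWithin S u t x = timeDerivWithin V u' t x := by
      rw [timeDerivWithin_apply, timeDerivWithin_apply, derivWithin_of_isOpen hS ht,
        derivWithin_of_isOpen hV htV]
      refine Filter.EventuallyEq.deriv_eq ?_
      filter_upwards [hV.mem_nhds htV] with s hs
      rw [hu s hs]
    rw [e1, hu t htV, hp t htV]
    exact h'.momentum t htV x
  divFree t ht := by
    obtain ⟨V, _, htV, -, u', p', h', hu, -⟩ := hloc t ht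
    rw [hu t htV]
    exact h'.divFree t htV

end Locality

/-! ### §2 The ancient classical DSS extension of a classical DSS germ -/

section Ancient

variable {E : Type*} [NormedAddCommGroup E] [InnerProductSpace ℝ E] [FiniteDimensional ℝ E]
variable {u : ℝ → E → E} {p : ℝ → E → ℝ} {c T₁ ν : ℝ}

/-- The set of times `s` with `(c⁻¹)²ᵏ s ∈ (T₁, 0)` is open and contained in `(−∞, 0)`; it is the
rescaled time set `(a² ·)⁻¹' (T₁, 0)` of `IsClassicalNSSolutionOn.nsRescale` for `a = (c⁻¹)ᵏ`.
[folklore] -/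
theorem isOpen_admissibleSet_and_subset (c : ℝ) (k : ℕ) (T₁ : ℝ) :
    IsOpen ((fun s : ℝ => (c⁻¹ ^ k) ^ 2 * s) ⁻¹' Ioo T₁ 0) ∧
      (fun s : ℝ => (c⁻¹ ^ k) ^ 2 * s) ⁻¹' Ioo T₁ 0 ⊆ Iio 0 := by
  refine ⟨isOpen_Ioo.preimage (continuous_const.mul continuous_id), fun s hs => ?_⟩
  have h2 : 0 ≤ (c⁻¹ ^ k) ^ 2 := sq_nonneg _
  have := hs.2
  simp only [mem_Iio]
  by_contra hneg
  have : 0 ≤ (c⁻¹ ^ k) ^ 2 * s := mul_nonneg h2 (not_lt.1 hneg)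
  linarith

/-- **A CLASSICAL DSS GERM IS THE TERMINAL PIECE OF AN ANCIENT CLASSICAL DSS SOLUTION.** Let
`c > 1`, `T₁ < 0`, and let `(u, p)` be a classical solution of the unforced Navier–Stokes system
(viscosity `ν`, any sign) on the time interval `(T₁, 0)` satisfying the germ relations
`nsRescale c⁻¹ u t = u t` and `nsRescalePressure c⁻¹ p t = p t` for `t ∈ (T₁, 0)`. Then there are
`ũ`, `p̃` with `IsDiscretelySelfSimilar c ũ`, `nsRescalePressure c p̃ = p̃`, `ũ t = u t` and
`p̃ t = p t` for `t ∈ (T₁, 0)`, and `IsClassicalNSSolutionOn (Iio 0) ν 0 ũ p̃`: an ancient classical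
`c`-DSS solution through the germ (unique among `c`-DSS fields by `dss_extension_unique`). Proof:
the extensions of `exists_dss_extension` / `exists_dssPressure_extension` equal
`(nsRescale (c⁻¹)ᵏ u, nsRescalePressure (c⁻¹)ᵏ p)` on the open set `{s : (c⁻¹)²ᵏ s ∈ (T₁, 0)}`,
where that pair is a classical solution by the DISCHARGED covariance
`IsClassicalNSSolutionOn.nsRescale_holds`; these sets cover `(−∞, 0)`, and classical solutions are
local in time (`isClassicalNSSolutionOn_of_locally`). [folklore] -/
theorem exists_ancient_classical_dss_extension (hc : 1 < c) (hT₁ : T₁ < 0)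
    (hsol : IsClassicalNSSolutionOn (Ioo T₁ 0) ν 0 u p)
    (hu : ∀ t ∈ Ioo T₁ 0, nsRescale c⁻¹ u t = u t)
    (hp : ∀ t ∈ Ioo T₁ 0, nsRescalePressure c⁻¹ p t = p t) :
    ∃ (v : ℝ → E → E) (q : ℝ → E → ℝ), IsDiscretelySelfSimilar c v ∧ nsRescalePressure c q = q ∧
      (∀ t ∈ Ioo T₁ 0, v t = u t) ∧ (∀ t ∈ Ioo T₁ 0, q t = p t) ∧
      IsClassicalNSSolutionOn (Iio 0) ν 0 v q := by
  have hc0 : 0 < c := zero_lt_one.trans hc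
  obtain ⟨v, hvdss, hvu, hvrep, -⟩ := exists_dss_extension hc hT₁ hu
  obtain ⟨q, hqdss, hqp, hqrep, -⟩ := exists_dssPressure_extension hc hT₁ hp
  refine ⟨v, q, hvdss, hqdss, hvu, hqp, isClassicalNSSolutionOn_of_locally isOpen_Iio fun t ht => ?_⟩
  obtain ⟨k, hk⟩ := exists_admissible_of_neg hc hT₁ ht
  set V : Set ℝ := (fun s : ℝ => (c⁻¹ ^ k) ^ 2 * s) ⁻¹' Ioo T₁ 0 with hV
  obtain ⟨hVopen, hVsub'⟩ := isOpen_admissibleSet_and_subset c k T₁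
  have ha : 0 < c⁻¹ ^ k := by positivity
  -- the rescaled copy of the germ is a classical solution on `V` (Leray covariance, discharged)
  have hres : IsClassicalNSSolutionOn V ν 0 (nsRescale (c⁻¹ ^ k) u) (nsRescalePressure (c⁻¹ ^ k) p) := by
    have h := IsClassicalNSSolutionOn.nsRescale_holds hsol ha
    rwa [nsRescaleForce_zero] at h
  exact ⟨V, hVopen, hk, hVsub', nsRescale (c⁻¹ ^ k) u, nsRescalePressure (c⁻¹ ^ k) p, hres,
    fun s hs => hvrep k s hs, fun s hs => hqrep k s hs⟩

omit [InnerProductSpace ℝ E] [FiniteDimensional ℝ E] in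
/-- **The Type-I bound passes to the extension with the same constant.** If the germ obeys the
scale-invariant bound `‖u(t, x)‖ ≤ C₀/(‖x‖ + √(−t))` for `t ∈ (T₁, 0)`, then any field `v` with the
representation property of `exists_dss_extension` (`v t = nsRescale (c⁻¹)ᵏ u t` whenever
`(c⁻¹)²ᵏ t ∈ (T₁, 0)`) satisfies the tree's `HasTypeIDecay C₀ v` on all of `t < 0` — the class of
the `rdssClass_*` floors (KNSS 2009 (1.6)), modulo the mild formulation. [folklore] -/
theorem hasTypeIDecay_of_germ [NormedSpace ℝ E] {F : Type*} [NormedAddCommGroup F] [NormedSpace ℝ F]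
    {u v : ℝ → E → F} {C₀ : ℝ} (hc : 1 < c) (hT₁ : T₁ < 0)
    (hTI : ∀ t ∈ Ioo T₁ 0, ∀ x : E, ‖u t x‖ ≤ C₀ / (‖x‖ + Real.sqrt (-t)))
    (hvrep : ∀ (k : ℕ) (t : ℝ), (c⁻¹ ^ k) ^ 2 * t ∈ Ioo T₁ 0 → v t = nsRescale (c⁻¹ ^ k) u t) :
    HasTypeIDecay C₀ v := by
  intro t ht x
  have hc0 : 0 < c := zero_lt_one.trans hc
  obtain ⟨k, hk⟩ := exists_admissible_of_neg hc hT₁ ht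
  set a : ℝ := c⁻¹ ^ k with ha
  have ha0 : 0 < a := by positivity
  have hs : 0 < Real.sqrt (-t) := Real.sqrt_pos.2 (by linarith)
  have hden : 0 < ‖x‖ + Real.sqrt (-t) := by positivity
  rw [hvrep k t hk, nsRescale_apply, norm_smul, Real.norm_of_nonneg ha0.le]
  have h1 := hTI (a ^ 2 * t) hk (a • x)
  have hsq : Real.sqrt (-(a ^ 2 * t)) = a * Real.sqrt (-t) := by
    rw [show -(a ^ 2 * t) = a ^ 2 * (-t) by ring, Real.sqrt_mul' _ (by linarith), Real.sqrt_sq ha0.le]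
  rw [norm_smul, Real.norm_of_nonneg ha0.le, hsq, ← mul_add] at h1
  calc a * ‖u (a ^ 2 * t) (a • x)‖ ≤ a * (C₀ / (a * (‖x‖ + Real.sqrt (-t)))) :=
        mul_le_mul_of_nonneg_left h1 ha0.le
    _ = C₀ / (‖x‖ + Real.sqrt (-t)) := by field_simp

end Ancient

end Summit.NavierStokesRegularity.FluidComputer.SelfSimilarCensus

end
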